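import Summits.QuantumFields.YangMills.Theorems.UnitScaleTiltProp8FlatActionCritical
import Summits.QuantumFields.YangMills.Theorems.UnitScaleTiltProp8ChartHInvComb
import Literature.MathematicalPhysics.QuantumFieldTheory.Balaban1983to89.B6SectAOperatorsV1
import HarnessLib

/-!
# Route `UnitScaleTilt`, crux K1 child «MinimiserStabilityRegPr» (stmt-QuantumFields-19200), registered stub V2′ `stub_halvingStep`
# (skeletons v8 5b4e846794b80374 / v10 `BirthV10`) — **THE TRACE PAIRING ON `ker Q` FROM A CONSTRAINED MINIMUM OF THE WILSON ACTION IN THE CHART** (owner MAP #3 M3,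
# producer side; file 11 of seat w3 g3): ★w5-19200 g2's `FlatActionCritical.re_gradient_pairing_eq_zero_of_isMinOn_wilson` instantiated at the competitor set
# `T = {X : bondwise self-adjoint, Q_{j(c)}X(c) = B(c) on the index bonds of a nested family D, X ∈ S}` (S open along lines through the minimiser) and the directions
# `δ = s•E` (`s` real with `Qs = 0` on the index bonds, `E` self-adjoint) — EXACTLY hypothesis (i) of `HalvingA1Row165TraceL5.row165_of_tracePairing_L5(_anyW)`

Cell `ym3-torus` (HUMAN RULING D-0037, YM ladder rung R3 — continuum SU(2) YM₃ on the torus is a RUNG, not the Clay problem), width seat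
`ym-ust-19200-w3` gen 3 (D-0149).  `--supports stmt-QuantumFields-19200 --as helper`; def-free, 0 sorry, standard axioms.

THE PRINT ([Balaban1985Variational] p. 297 (127), p. 301–302 (150), (157)): the charted Wilson functional is minimal over the constraint space of the cube sequence
(«this space is defined by more restrictive functional conditions»), whose linear constraints are `L^jηQ_jA′ = B on Λ′_j, j = 0,…,k` — the multi-level `Q` of
[Balaban1984PropagatorsII] (2.20) for the nested family; outside `Ω₁` every bond is a level-0 index bond with `Q₀ = id`, so test fields in `ker Q` vanish there.
WHAT THIS FILE PROVES: **`tracePairing_of_isMinOn`** — see the docstring.  HONEST SCOPE: bookkeeping (the segment `A + t·s•E` stays self-adjoint, keeps every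
`Q`-constraint, and stays in `S`); the minimality itself (P5: the route's minimiser read in the chart, WITHOUT a gauge condition in `T` — print's p.297 extension) and
the chart `U` are hypotheses.  NOT a claim about the crux, the rung, or the mass gap.

References: T. Bałaban, CMP **102** (1985) 277–309 [Balaban1985Variational] (99)–(100) p.293, (127) p.297, (150) p.301, (157)–(158) p.302; CMP **96** (1984) 223–250
[Balaban1984PropagatorsII] (2.20) p.226.
-/

set_option autoImplicit false

noncomputable section

open scoped BigOperators Matrix.Norms.L2Operator
open NormedSpace Finset

namespace Summit.QuantumFields.YangMills.Theorems.HalvingELMinimality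

open Literature.MathematicalPhysics.QuantumFieldTheory.Balaban1983to89
open B6SectADomainsV1 (Domains)
open B6SectAOperatorsV1 (BondIdx QE QE_apply)
open LatticeFieldCalculus (bondAvgIter)
open Literature.MathematicalPhysics.QuantumFieldTheory.BalabanImbrieJaffe1984to88.BIJ85AxialPropagator411 (bondAvgIter_add bondAvgIter_smul)
open FlatActionCritical (re_gradient_pairing_eq_zero_of_isMinOn_wilson)

variable {P : Params}

/-- **THE TRACE PAIRING ON `ker Q` FROM A CONSTRAINED MINIMUM IN THE CHART**: for the competitor set `T = {X | X bondwise self-adjoint ∧ (∀ c, Q_{j(c)}X(c) = B(c)) ∧ X ∈ S}`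
of a nested family `D`, `S` open along every line through `A`, a chart `U` with `↑(U X)(b) = e^{iηX(b)}` on `T`, and a minimiser `A ∈ T` of `X ↦ wilsonAction4 (U X)` over `T`:
for every real `s` with `Qs = 0` on the index bonds and every self-adjoint `E`, the trace pairing at `δ = s•E` has zero real part — hypothesis (i) of
`HalvingA1Row165TraceL5.row165_of_tracePairing_L5_anyW`. [cite: Balaban1985Variational, (99)-(100) p.293, (127) p.297, (150) p.301, (157)-(158) p.302] -/
theorem tracePairing_of_isMinOn (D : Domains P) (η : ℝ) (W : (PBond P 0 → Matrix (Fin 2) (Fin 2) ℂ) → (PBond P 0 → Matrix (Fin 2) (Fin 2) ℂ))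
    (hSd : Differentiable ℂ (fun A : PBond P 0 → Matrix (Fin 2) (Fin 2) ℂ => (∑ p : Plaq P 0, (1 - (2 : ℂ)⁻¹ * Matrix.trace (exp ((Complex.I * (η : ℂ)) • A ⟨p.src, p.μ⟩) * exp ((Complex.I * (η : ℂ)) • A ⟨p.src.shift p.μ, p.ν⟩) * exp (-((Complex.I * (η : ℂ)) • A ⟨p.src.shift p.ν, p.μ⟩)) * exp (-((Complex.I * (η : ℂ)) • A ⟨p.src, p.ν⟩)))))))
    (hgrad : ∀ A δ : PBond P 0 → Matrix (Fin 2) (Fin 2) ℂ, fderiv ℂ (fun A : PBond P 0 → Matrix (Fin 2) (Fin 2) ℂ => (∑ p : Plaq P 0, (1 - (2 : ℂ)⁻¹ * Matrix.trace (exp ((Complex.I * (η : ℂ)) • A ⟨p.src, p.μ⟩) * exp ((Complex.I * (η : ℂ)) • A ⟨p.src.shift p.μ, p.ν⟩) * exp (-((Complex.I * (η : ℂ)) • A ⟨p.src.shift p.ν, p.μ⟩)) * exp (-((Complex.I * (η : ℂ)) • A ⟨p.src, p.ν⟩)))))) A δ =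
      ((η : ℂ) ^ 2 / 2) * ∑ p : Plaq P 0, Matrix.trace ((A ⟨p.src, p.μ⟩ + A ⟨p.src.shift p.μ, p.ν⟩ - A ⟨p.src.shift p.ν, p.μ⟩ - A ⟨p.src, p.ν⟩) * (δ ⟨p.src, p.μ⟩ + δ ⟨p.src.shift p.μ, p.ν⟩ - δ ⟨p.src.shift p.ν, p.μ⟩ - δ ⟨p.src, p.ν⟩)) + (η : ℂ) ^ 4 * ∑ b : PBond P 0, Matrix.trace (W A b * δ b))
    {S : Set (PBond P 0 → Matrix (Fin 2) (Fin 2) ℂ)} {Bdat : BondIdx D → Matrix (Fin 2) (Fin 2) ℂ}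
    (U : (PBond P 0 → Matrix (Fin 2) (Fin 2) ℂ) → GaugeField P 0 (Matrix.specialUnitaryGroup (Fin 2) ℂ))
    (hU : ∀ X ∈ {X : PBond P 0 → Matrix (Fin 2) (Fin 2) ℂ | (∀ b, IsSelfAdjoint (X b)) ∧ (∀ c : BondIdx D, bondAvgIter (c.1.1 : ℕ) X c.1.2 = Bdat c) ∧ X ∈ S},
      ∀ b, ((U X b : Matrix.specialUnitaryGroup (Fin 2) ℂ) : Matrix (Fin 2) (Fin 2) ℂ) = exp ((Complex.I * (η : ℂ)) • X b))
    {A : PBond P 0 → Matrix (Fin 2) (Fin 2) ℂ} (hAsa : ∀ b, IsSelfAdjoint (A b)) (hAQ : ∀ c : BondIdx D, bondAvgIter (c.1.1 : ℕ) A c.1.2 = Bdat c) (hAS : A ∈ S)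
    (hS : ∀ δ : PBond P 0 → Matrix (Fin 2) (Fin 2) ℂ, ∃ r : ℝ, 0 < r ∧ ∀ t : ℝ, |t| < r → A + t • δ ∈ S)
    (hmin : IsMinOn (fun X => wilsonAction4 (U X))
      {X : PBond P 0 → Matrix (Fin 2) (Fin 2) ℂ | (∀ b, IsSelfAdjoint (X b)) ∧ (∀ c : BondIdx D, bondAvgIter (c.1.1 : ℕ) X c.1.2 = Bdat c) ∧ X ∈ S} A) :
    ∀ s : PBond P 0 → ℝ, QE D (WithLp.toLp 2 s) = 0 → ∀ E : Matrix (Fin 2) (Fin 2) ℂ, IsSelfAdjoint E →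
    (((η : ℂ) ^ 2 / 2) * ∑ p : Plaq P 0, Matrix.trace ((A ⟨p.src, p.μ⟩ + A ⟨p.src.shift p.μ, p.ν⟩ - A ⟨p.src.shift p.ν, p.μ⟩ - A ⟨p.src, p.ν⟩) * (((s ⟨p.src, p.μ⟩ : ℝ) : ℂ) • E + ((s ⟨p.src.shift p.μ, p.ν⟩ : ℝ) : ℂ) • E - ((s ⟨p.src.shift p.ν, p.μ⟩ : ℝ) : ℂ) • E - ((s ⟨p.src, p.ν⟩ : ℝ) : ℂ) • E)) + (η : ℂ) ^ 4 * ∑ b : PBond P 0, Matrix.trace (W A b * (((s b : ℝ) : ℂ) • E))).re = 0 := by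
  intro s hs E hE
  set δ : PBond P 0 → Matrix (Fin 2) (Fin 2) ℂ := fun b => ((s b : ℝ) : ℂ) • E with hδdef
  obtain ⟨r, hr, hSr⟩ := hS δ
  have hQs : ∀ c : BondIdx D, bondAvgIter (c.1.1 : ℕ) s c.1.2 = 0 := fun c => by
    have h := congrArg (fun v : B6SectAOperatorsV1.BondIdxSpace D => v c) hs
    simpa [QE_apply] using h
  have hδφ : δ = fun b => (LinearMap.toSpanSingleton ℝ (Matrix (Fin 2) (Fin 2) ℂ) E) (s b) := by
    funext b
    show ((s b : ℝ) : ℂ) • E = (LinearMap.toSpanSingleton ℝ (Matrix (Fin 2) (Fin 2) ℂ) E) (s b)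
    rw [LinearMap.toSpanSingleton_apply, Complex.coe_smul]
  have hT : ∀ t : ℝ, |t| < r →
      A + t • δ ∈ {X : PBond P 0 → Matrix (Fin 2) (Fin 2) ℂ | (∀ b, IsSelfAdjoint (X b)) ∧ (∀ c : BondIdx D, bondAvgIter (c.1.1 : ℕ) X c.1.2 = Bdat c) ∧ X ∈ S} := by
    intro t ht
    refine ⟨fun b => ?_, fun c => ?_, hSr t ht⟩
    · -- the segment stays bondwise self-adjoint
      show IsSelfAdjoint (A b + t • (((s b : ℝ) : ℂ) • E))
      rw [Complex.coe_smul]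
      exact (hAsa b).add (IsSelfAdjoint.smul (IsSelfAdjoint.all t) (IsSelfAdjoint.smul (IsSelfAdjoint.all (s b)) hE))
    · -- the segment keeps every constraint: `Q(s•E) = (Qs)•E = 0`
      rw [bondAvgIter_add, bondAvgIter_smul, Pi.add_apply, Pi.smul_apply, hAQ c, hδφ,
        ChartHInv.bondAvgIter_comp_apply (LinearMap.toSpanSingleton ℝ (Matrix (Fin 2) (Fin 2) ℂ) E) (c.1.1 : ℕ) s c.1.2, hQs c, map_zero, smul_zero, add_zero]
  have h := re_gradient_pairing_eq_zero_of_isMinOn_wilson η W hSd hgrad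
    (T := {X : PBond P 0 → Matrix (Fin 2) (Fin 2) ℂ | (∀ b, IsSelfAdjoint (X b)) ∧ (∀ c : BondIdx D, bondAvgIter (c.1.1 : ℕ) X c.1.2 = Bdat c) ∧ X ∈ S})
    (fun X hX => hX.1) U hU (A := A) (δ := δ) ⟨hAsa, hAQ, hAS⟩ hr hT hmin
  exact h

end Summit.QuantumFields.YangMills.Theorems.HalvingELMinimality

end
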